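import Summits.QuantumFields.BalabanUV.T4Continuum.Spine.NE9.MemoryFromRate

/-!
# Spine/NE4/TowerRateFromMemory — (R63) in the TOWER vocabulary of `Spine/NE9/MemoryFromRate`: on an abstract tower the RATE (tower-NE5)
# and the MEMORY (fading oscillation) are ONE estimate modulo a frozen-block comparison with ANY finite live loss — ne9's C24 gives
# RATE ⇒ MEMORY, this file gives MEMORY + frozen gain∕loss ⇒ RATE, with no threshold (cell `pub-balaban-gaps`, seat ne4, generation 20;
# census item (R63) of `HOME/ne/NE4.md` §5; β-level original `Spine/NE4/ScaleShiftFrozenHistory.lean`, activity-level `…/OutputRateFrozenHistory.lean`)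

HONEST FRAMING.  Bookkeeping for rung (B)+1 on ONE FIXED finite four-torus — NOT ℝ⁴, NOT infinite volume, NOT a mass gap, NOT Clay.
Real analysis on HYPOTHESIS SHAPES about a bare tower `F : ℕ → (ℕ → ℝ) → ℝ` (the term of one physical localization domain at scale index
`m` of the run in which it has that index, as in `NE9.MemoryFromRate`); tower-NE5, NE9 and NE4 are the cell's estimates, NOT PRINTED
([Balaban1987RG1] p. 263 ∕ p. 264 ∕ p. 298 give qualitative statements only) and NOT PROVED; nothing of Bałaban's is asserted; no word of
rows NE5 ∕ NE9 moves; spine estimates proved 0∕9.  0 sorry.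

WHAT.  `NE9.MemoryFromRate.osc_le_of_towerRate` (ne9 gen 3): on a shift-closed window `W`, the TOWER RATE
`|F (m+1) g − F m (g ∘ succ)| ≤ C₅·θ^m` (tower-NE5: prepend one bare coupling, refine once) gives OSCILLATION MEMORY — two admissible
histories agreeing at every index `≥ a` satisfy `|F (m+a) g − F (m+a) g'| ≤ 2C₅θ^m∕(1−θ)`.  Here the converse modulo soft inputs:
* §1 `OscMemory F W C ω` (hypothesis shape = the conclusion shape of ne9's theorem, rate `ω`), `FrozenTower F W φ` (for every `M`,
  `a ≤ M+1`, every `g ∈ W` and tolerance `η`, SOME `g' ∈ W` agreeing with `g` at all indices `≥ a` — e.g. `g` with its `a` oldest couplings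
  frozen at `ε → 0⁺` — has `|F (M+1) g' − F M (g' ∘ succ)| ≤ φ M a + η`: the tower comparison ONLY on old-block-modified histories of one's
  choosing); `oscMemory_of_towerRate` re-exports ne9's direction in this shape.
* §2 `towerShift_le_frozen` ∕ `towerEnvelope_of_frozenTower`: the tower comparison at level `M` is at most `2·C·ω^{M+1−a}` plus the
  frozen-block comparison, for every `a ≤ M+1`; `frozenTower_of_towerRate`: the converse is trivial (take `g' = g`).
* §3 `towerRate_of_frozenTower_root` ∕ `exists_towerRate_of_frozenTower`: with `φ M a = A·Λ^{M+1−a}·θ₀^a` (gain `θ₀ ≤ 1` per frozen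
  step, loss `Λ ≥ 0` OF ANY SIZE per live step) the «p frozen : 1 live» split gives the tower rate at every `θ′ ∈ ]0,1]` with
  `ω ≤ θ′^{p+1}`, `Λθ₀^p ≤ θ′^{p+1}`, and SOME `θ′ < 1` whenever `ω < 1 ∧ θ₀ < 1` — NO threshold couples `Λ` to `ω`.
So on the abstract tower: RATE ⇒ MEMORY (ne9's C24) and MEMORY + frozen-block gain∕loss ⇒ RATE (this file): the two unprinted structural
estimates of the spine's history side are ONE estimate in two currencies, modulo the frozen-block bound whose natural producer is
{settling of the FREE data at the frozen depth (rows NE2∕NE3, LINEAR) × Lipschitz STABILITY of the live interacting steps with ANY k-uniform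
constant ([Balaban1988RG2Cluster] Lemma 3 (2.38)'s analyticity by Cauchy)} — a READING, labelled; the hypothesis allows any modification
of the old block.

References (TYPES only): [Balaban1987RG1] = T. Bałaban, Commun. Math. Phys. **109** (1987) 249–301, p. 263, p. 298; [Balaban1988RG2Cluster]
= CMP **116** (1988) 1–22, Lemma 3 (2.38) p. 20; C. King, CMP **102** (1986) Thm 3.4 (3.9) p. 656 (shape only).
-/

noncomputable section

namespace Summit.QuantumFields.BalabanUV.T4Continuum.Spine.NE4.TowerRateFromMemory

open Summit.QuantumFields.BalabanUV.T4Continuum.NE9.MemoryFromRate (osc_le_of_towerRate)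

variable {W : Set (ℕ → ℝ)} {F : ℕ → (ℕ → ℝ) → ℝ}

/-! ## §1 The two hypothesis shapes and ne9's direction re-exported -/

/-- HYPOTHESIS SHAPE — OSCILLATION MEMORY at rate `ω` (the CONCLUSION shape of `NE9.MemoryFromRate.osc_le_of_towerRate`, here a binder): two
admissible histories agreeing at every index `≥ a` give, `m` levels above the modified block, `|F (m+a) g − F (m+a) g'| ≤ C·ω^m`.  The
history-side companion of the spine (NE9's decay half) in oscillation form.  NOT PRINTED; NOT a fact. [cite: Balaban1987RG1, §5 p.298] -/
def OscMemory (F : ℕ → (ℕ → ℝ) → ℝ) (W : Set (ℕ → ℝ)) (C ω : ℝ) : Prop :=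
  ∀ (a m : ℕ) (g g' : ℕ → ℝ), g ∈ W → g' ∈ W → (∀ i, a ≤ i → g i = g' i) → |F (m + a) g - F (m + a) g'| ≤ C * ω ^ m

/-- HYPOTHESIS SHAPE — THE TOWER COMPARISON ON OLD-BLOCK-MODIFIED HISTORIES ONLY, with an arbitrary two-parameter envelope `φ M a`: for
every level `M`, every `a ≤ M+1`, every `g ∈ W` and every `η > 0` there is SOME `g' ∈ W` agreeing with `g` at all indices `≥ a` (e.g. `g` with
its `a` oldest couplings frozen at a value of one's choosing) with `|F (M+1) g' − F M (g' ∘ succ)| ≤ φ M a + η`.  NOT PRINTED; NOT a fact.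
[cite: Balaban1987RG1, (1.18) p.263] -/
def FrozenTower (F : ℕ → (ℕ → ℝ) → ℝ) (W : Set (ℕ → ℝ)) (φ : ℕ → ℕ → ℝ) : Prop :=
  ∀ (M a : ℕ), a ≤ M + 1 → ∀ g ∈ W, ∀ η : ℝ, 0 < η →
    ∃ g' : ℕ → ℝ, g' ∈ W ∧ (∀ i, a ≤ i → g' i = g i) ∧ |F (M + 1) g' - F M (fun i => g' (i + 1))| ≤ φ M a + η

/-- **RATE ⇒ MEMORY (ne9's C24, re-exported in this file's shape).**  On a shift-closed window the tower rate `C₅θ^m` (`C₅ ≥ 0`,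
`0 ≤ θ < 1`) gives `OscMemory F W (2C₅∕(1−θ)) θ` — `NE9.MemoryFromRate.osc_le_of_towerRate` by name. [folklore] -/
theorem oscMemory_of_towerRate {C₅ θ : ℝ} (hC : 0 ≤ C₅) (hθ0 : 0 ≤ θ) (hθ1 : θ < 1)
    (hW : ∀ g ∈ W, (fun i => g (i + 1)) ∈ W)
    (hT : ∀ m, ∀ g ∈ W, |F (m + 1) g - F m (fun i => g (i + 1))| ≤ C₅ * θ ^ m) :
    OscMemory F W (2 * C₅ / (1 - θ)) θ := by
  intro a m g g' hg hg' hagree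
  have h := osc_le_of_towerRate hC hθ0 hθ1 hW hT (a := a) (m := m) hg hg' hagree
  calc |F (m + a) g - F (m + a) g'| ≤ 2 * C₅ * θ ^ m / (1 - θ) := h
    _ = 2 * C₅ / (1 - θ) * θ ^ m := by ring

/-! ## §2 The tower comparison up to an old block, given the memory -/

/-- **THE TOWER COMPARISON UP TO A MODIFIED OLD BLOCK.**  Under `OscMemory F W C ω` (`C ≥ 0`, `0 ≤ ω`) on a shift-closed window, for `g, g' ∈ W`
agreeing at all indices `≥ a`, `a ≤ M+1`: `|F (M+1) g − F M (g ∘ succ)| ≤ 2·C·ω^{M+1−a} + |F (M+1) g' − F M (g' ∘ succ)|` — both members of the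
comparison move by at most `C·ω^{M+1−a}` when the `a` oldest couplings are modified (for the lower member the shifted histories agree from
index `a − 1` on, one level lower). [cite: Balaban1987RG1, §5 p.298] -/
theorem towerShift_le_frozen {C ω : ℝ} (hO : OscMemory F W C ω) (hC : 0 ≤ C) (hω0 : 0 ≤ ω)
    (hW : ∀ g ∈ W, (fun i => g (i + 1)) ∈ W) {M a : ℕ} (ha : a ≤ M + 1) {g g' : ℕ → ℝ} (hg : g ∈ W) (hg' : g' ∈ W)
    (hagree : ∀ i, a ≤ i → g' i = g i) :
    |F (M + 1) g - F M (fun i => g (i + 1))|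
      ≤ 2 * (C * ω ^ (M + 1 - a)) + |F (M + 1) g' - F M (fun i => g' (i + 1))| := by
  -- upper member: g and g' agree from a on; level M+1 = (M+1-a) + a
  have h1 : |F (M + 1) g - F (M + 1) g'| ≤ C * ω ^ (M + 1 - a) := by
    have h := hO a (M + 1 - a) g g' hg hg' fun i hi => (hagree i hi).symm
    have e : M + 1 - a + a = M + 1 := by omega
    rw [e] at h
    exact h
  -- lower member: the shifted histories agree from (a-1) on, level M = (M+1-a) + (a-1) when a ≥ 1; when a = 0 they are equal
  have h2 : |F M (fun i => g (i + 1)) - F M (fun i => g' (i + 1))| ≤ C * ω ^ (M + 1 - a) := by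
    rcases Nat.eq_zero_or_pos a with ha0 | ha0
    · subst ha0
      have : (fun i => g (i + 1)) = fun i => g' (i + 1) := funext fun i => (hagree (i + 1) (Nat.zero_le _)).symm
      rw [this, sub_self, abs_zero]; positivity
    · have h := hO (a - 1) (M + 1 - a) _ _ (hW g hg) (hW g' hg') fun i hi => (hagree (i + 1) (by omega)).symm
      have e : M + 1 - a + (a - 1) = M := by omega
      rw [e] at h
      exact h
  rw [abs_sub_comm] at h2
  calc |F (M + 1) g - F M (fun i => g (i + 1))|
      = |(F (M + 1) g - F (M + 1) g') + (F (M + 1) g' - F M (fun i => g' (i + 1)))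
          + (F M (fun i => g' (i + 1)) - F M (fun i => g (i + 1)))| := by ring_nf
    _ ≤ |F (M + 1) g - F (M + 1) g'| + |F (M + 1) g' - F M (fun i => g' (i + 1))|
          + |F M (fun i => g' (i + 1)) - F M (fun i => g (i + 1))| := abs_add_three _ _ _
    _ ≤ C * ω ^ (M + 1 - a) + |F (M + 1) g' - F M (fun i => g' (i + 1))| + C * ω ^ (M + 1 - a) :=
        add_le_add (add_le_add h1 le_rfl) h2
    _ = _ := by ring

/-- **GENERAL ENVELOPES.**  `OscMemory F W C ω` + `FrozenTower F W φ` on a shift-closed window ⇒ for every `M`, `a ≤ M+1`, `g ∈ W`: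
`|F (M+1) g − F M (g ∘ succ)| ≤ 2Cω^{M+1−a} + φ M a`. [folklore] -/
theorem towerEnvelope_of_frozenTower {C ω : ℝ} {φ : ℕ → ℕ → ℝ} (hO : OscMemory F W C ω) (hC : 0 ≤ C) (hω0 : 0 ≤ ω)
    (hW : ∀ g ∈ W, (fun i => g (i + 1)) ∈ W) (hF : FrozenTower F W φ) :
    ∀ (M a : ℕ), a ≤ M + 1 → ∀ g ∈ W, |F (M + 1) g - F M (fun i => g (i + 1))| ≤ 2 * (C * ω ^ (M + 1 - a)) + φ M a := by
  intro M a ha g hg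
  refine le_of_forall_pos_le_add fun η hη => ?_
  obtain ⟨g', hg', hagree, hφ⟩ := hF M a ha g hg η hη
  have h := towerShift_le_frozen hO hC hω0 hW ha hg hg' hagree
  linarith

/-- **THE CONVERSE** (trivial): the tower rate `C₅θ^M` gives `FrozenTower F W (fun M _ ↦ C₅·θ^M)` with `g' = g`. [folklore] -/
theorem frozenTower_of_towerRate {C₅ θ : ℝ}
    (hT : ∀ m, ∀ g ∈ W, |F (m + 1) g - F m (fun i => g (i + 1))| ≤ C₅ * θ ^ m) :
    FrozenTower F W (fun M _ => C₅ * θ ^ M) := by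
  intro M a _ g hg η hη
  exact ⟨g, hg, fun _ _ => rfl, (hT M g hg).trans (le_add_of_nonneg_right hη.le)⟩

/-! ## §3 Gain per frozen step, loss per live step: the tower rate with NO threshold -/

/-- **THE p : 1 SPLIT FOR THE TOWER.**  `OscMemory F W C ω` + `FrozenTower F W (fun M a ↦ A·Λ^{M+1−a}·θ₀^a)` (gain
`θ₀ ∈ [0,1]` per frozen step, loss `Λ ≥ 0` OF ANY SIZE per live step, `A ≥ 0`; `C, ω ≥ 0`) on a shift-closed window: if `p : ℕ` and `θ′ ∈ ]0,1]` satisfy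
`ω ≤ θ′^{p+1}` and `Λ·θ₀^p ≤ θ′^{p+1}`, then the TOWER RATE holds at `θ′`:
`|F (M+1) g − F M (g ∘ succ)| ≤ ((2C + A)∕θ′^p)·θ′^M` for all `M`, `g ∈ W` — split the `M+1` positions as `t = ⌊(M+1)∕(p+1)⌋` live, the rest
frozen.  NO condition relates `Λ` to `ω`. [folklore] -/
theorem towerRate_of_frozenTower_root {C ω A Λ θ₀ θ' : ℝ} {p : ℕ} (hO : OscMemory F W C ω) (hC : 0 ≤ C) (hω0 : 0 ≤ ω)
    (hW : ∀ g ∈ W, (fun i => g (i + 1)) ∈ W) (hA : 0 ≤ A) (hΛ : 0 ≤ Λ) (hθ0 : 0 ≤ θ₀) (hθ1 : θ₀ ≤ 1)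
    (hθ'0 : 0 < θ') (hθ'1 : θ' ≤ 1) (hωθ' : ω ≤ θ' ^ (p + 1)) (hΛθ' : Λ * θ₀ ^ p ≤ θ' ^ (p + 1))
    (hF : FrozenTower F W (fun M a => A * Λ ^ (M + 1 - a) * θ₀ ^ a)) :
    ∀ M, ∀ g ∈ W, |F (M + 1) g - F M (fun i => g (i + 1))| ≤ (2 * C + A) / θ' ^ p * θ' ^ M := by
  intro M g hg
  set t := (M + 1) / (p + 1) with ht
  have ht1 : (p + 1) * t ≤ M + 1 := Nat.mul_div_le (M + 1) (p + 1)
  have ht2 : M + 1 < (p + 1) * (t + 1) := Nat.lt_mul_div_succ (M + 1) (Nat.succ_pos p)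
  have htk : t ≤ M + 1 := Nat.div_le_self _ _
  have hlin1 : (p + 1) * (t + 1) = (p + 1) * t + (p + 1) := by ring
  have hlin2 : (p + 1) * t = p * t + t := by ring
  have ha : M + 1 - t ≤ M + 1 := Nat.sub_le _ _
  have henv := towerEnvelope_of_frozenTower hO hC hω0 hW hF M (M + 1 - t) ha g hg
  have e1 : M + 1 - (M + 1 - t) = t := by omega
  rw [e1] at henv
  set ρ := θ' ^ (p + 1) with hρ
  have hωt : ω ^ t ≤ ρ ^ t := pow_le_pow_left₀ hω0 hωθ' t
  have hpt : p * t ≤ M + 1 - t := by omega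
  have hΛt : Λ ^ t * θ₀ ^ (M + 1 - t) ≤ ρ ^ t := by
    calc Λ ^ t * θ₀ ^ (M + 1 - t) ≤ Λ ^ t * θ₀ ^ (p * t) :=
          mul_le_mul_of_nonneg_left (pow_le_pow_of_le_one hθ0 hθ1 hpt) (pow_nonneg hΛ _)
      _ = (Λ * θ₀ ^ p) ^ t := by rw [mul_pow, ← pow_mul]
      _ ≤ ρ ^ t := pow_le_pow_left₀ (mul_nonneg hΛ (pow_nonneg hθ0 _)) hΛθ' t
  have hρt : ρ ^ t ≤ θ' ^ M / θ' ^ p := by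
    have hθ'p : 0 < θ' ^ p := pow_pos hθ'0 p
    rw [le_div_iff₀ hθ'p, hρ, ← pow_mul, ← pow_add]
    exact pow_le_pow_of_le_one hθ'0.le hθ'1 (by omega)
  have hK : 0 ≤ 2 * C + A := by positivity
  calc |F (M + 1) g - F M (fun i => g (i + 1))|
      ≤ 2 * (C * ω ^ t) + A * Λ ^ t * θ₀ ^ (M + 1 - t) := henv
    _ = 2 * C * ω ^ t + A * (Λ ^ t * θ₀ ^ (M + 1 - t)) := by ring
    _ ≤ 2 * C * ρ ^ t + A * ρ ^ t :=
        add_le_add (mul_le_mul_of_nonneg_left hωt (by positivity)) (mul_le_mul_of_nonneg_left hΛt hA)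
    _ = (2 * C + A) * ρ ^ t := by ring
    _ ≤ (2 * C + A) * (θ' ^ M / θ' ^ p) := mul_le_mul_of_nonneg_left hρt hK
    _ = (2 * C + A) / θ' ^ p * θ' ^ M := by ring

/-- **MEMORY + FROZEN GAIN∕LOSS ⇒ RATE, FOR EVERY FINITE LOSS.**  `OscMemory F W C ω` with `ω < 1` + `FrozenTower` with gain `θ₀ < 1` and ANY loss
`Λ ≥ 0` on a shift-closed window ⇒ the TOWER RATE (tower-NE5) at some rate below one:
`∃ C₅ ≥ 0, ∃ θ′ ∈ [0,1[, ∀ M, ∀ g ∈ W, |F (M+1) g − F M (g ∘ succ)| ≤ C₅·θ′^M` — the converse of `oscMemory_of_towerRate` modulo the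
frozen-block bound; with it, RATE and MEMORY are one estimate in two currencies on the abstract tower.  HYPOTHESES ONLY. [folklore] -/
theorem exists_towerRate_of_frozenTower {C ω A Λ θ₀ : ℝ} (hO : OscMemory F W C ω) (hC : 0 ≤ C) (hω0 : 0 ≤ ω) (hω1 : ω < 1)
    (hW : ∀ g ∈ W, (fun i => g (i + 1)) ∈ W) (hA : 0 ≤ A) (hΛ : 0 ≤ Λ) (hθ0 : 0 ≤ θ₀) (hθ1 : θ₀ < 1)
    (hF : FrozenTower F W (fun M a => A * Λ ^ (M + 1 - a) * θ₀ ^ a)) :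
    ∃ C₅ θ' : ℝ, 0 ≤ C₅ ∧ 0 ≤ θ' ∧ θ' < 1 ∧ ∀ M, ∀ g ∈ W, |F (M + 1) g - F M (fun i => g (i + 1))| ≤ C₅ * θ' ^ M := by
  obtain ⟨p, hp⟩ : ∃ p : ℕ, θ₀ ^ p < 1 / (Λ + 1) := exists_pow_lt_of_lt_one (by positivity) hθ1
  have hΛp : Λ * θ₀ ^ p < 1 := by
    have hΛ1 : 0 < Λ + 1 := by linarith
    calc Λ * θ₀ ^ p ≤ (Λ + 1) * θ₀ ^ p := mul_le_mul_of_nonneg_right (by linarith) (pow_nonneg hθ0 _)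
      _ < (Λ + 1) * (1 / (Λ + 1)) := mul_lt_mul_of_pos_left hp hΛ1
      _ = 1 := by field_simp
  set ρ := max (max ω (Λ * θ₀ ^ p)) (1 / 2) with hρ
  have hρpos : 0 < ρ := lt_of_lt_of_le (by norm_num) (le_max_right _ _)
  have hρ1 : ρ < 1 := max_lt (max_lt hω1 hΛp) (by norm_num)
  have hωρ : ω ≤ ρ := (le_max_left _ _).trans (le_max_left _ _)
  have hΛρ : Λ * θ₀ ^ p ≤ ρ := (le_max_right _ _).trans (le_max_left _ _)
  set θ' : ℝ := ρ ^ ((1 : ℝ) / (p + 1)) with hθ'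
  have hexp : 0 < (1 : ℝ) / (p + 1) := by positivity
  have hθ'0 : 0 < θ' := Real.rpow_pos_of_pos hρpos _
  have hθ'1 : θ' < 1 := Real.rpow_lt_one hρpos.le hρ1 hexp
  have hpow : θ' ^ (p + 1) = ρ := by
    rw [hθ', ← Real.rpow_natCast, ← Real.rpow_mul hρpos.le]
    have : (1 : ℝ) / (p + 1) * ((p + 1 : ℕ) : ℝ) = 1 := by
      rw [Nat.cast_add_one]; field_simp
    rw [this, Real.rpow_one]
  refine ⟨(2 * C + A) / θ' ^ p, θ', by positivity, hθ'0.le, hθ'1, ?_⟩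
  exact towerRate_of_frozenTower_root hO hC hω0 hW hA hΛ hθ0 hθ1.le hθ'0 hθ'1.le
    (hωρ.trans hpow.symm.le) (hΛρ.trans hpow.symm.le) hF

end Summit.QuantumFields.BalabanUV.T4Continuum.Spine.NE4.TowerRateFromMemory

end
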